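import Literature.NumberTheory.Automorphic.TamagawaHeckeSeries
import Literature.LinearAlgebra.Subspace.MoebiusCount
import Mathlib.RingTheory.PowerSeries.WellKnown
import Mathlib.Analysis.Normed.Ring.InfiniteSum
import Mathlib.Analysis.SpecificLimits.Normed
import HarnessLib

/-!
# The number of left cosets in `Δ_m` and the radius of convergence of the Hecke series of `GL_n`

Topic `NumberTheory/Automorphic`; theorems only (no definition, no named fact), complement to
`TamagawaHeckeSeries` (Tamagawa's rationality theorem `(∑_m T(ϖ^m) X^m)(∑_i (-1)^i q^{i(i-1)/2} T_i X^i) = 1`,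
Shimura (1971), Thm. 3.21) and `HeckeSeriesConvergence`. Setting: a field `F` with a valuation
(`ValuativeRel F`), finite residue field `𝓀` with `q` elements, a uniformizing element `ϖ`,
`K = GL_n(𝒪)`, `t_i = diag(ϖ 1_i, 1_{n-i})`, `Δ_m = {y integral : |det y| = |ϖ|^m}` (`glIntDet`).

## Main statements (all proved)

* `sum_card_ge_codim_mul_pow_eq_prod` (**the `q`-binomial theorem through subspace counts**): over
  a finite field with `q` elements, for a subspace `C` of a finite-dimensional space `W` and `x` in
  any commutative ring,
  `∑_j (-1)^j q^{j(j-1)/2} #{Y ⊇ C : codim Y = j} x^j = ∏_{i < codim C} (1 - q^i x)`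
  — the polynomial identity whose value at `x = 1` is Shimura's Lemma 3.23
  (`Literature.LinearAlgebra.Subspace.sum_neg_one_pow_mul_pow_choose_mul_card_ge_codim`); same proof, by the
  recursion `card_ge_codim_eq_add` of `MoebiusCount` (`q`-Pascal rule).
* `ncard_orbit_heckeDiag_eq_card_submodule`: the degree `#(K t_i K / K)` of `T_i` is the number of
  subspaces of `𝓀ⁿ` of codimension `i` (from the lattice count
  `ncard_orbit_heckeDiag_isIntegralMatrix` of `HeckeLatticeCount`, at `w = ϖ · 1`).
* `sum_ncard_orbit_heckeDiag_mul_pow_eq_prod`: hence the Hecke polynomial of the *trivial*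
  representation is `∑_i (-1)^i q^{i(i-1)/2} #(K t_i K/K) x^i = ∏_{i<n} (1 - q^i x)`.
* `mk_ncard_cosets_glIntDet_mul_prod_eq_one` (**generating function of `#(Δ_m K/K)`**): Tamagawa's
  identity applied to the trivial one-dimensional representation (every vector `K`-fixed, `[KgK]`
  acting by the degree) gives `(∑_m #(Δ_m K/K) X^m) · ∏_{i<n} (1 - q^i X) = 1` in `ℝ⟦X⟧` — the
  classical count of the lattices of index `q^m` in `𝒪ⁿ`, `∑_m #(Δ_m K/K) X^m = ∏_{i=0}^{n-1} (1 - q^i X)⁻¹`.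
* `summable_ncard_cosets_glIntDet_mul_pow` (**radius of convergence `q^{-(n-1)}`**): for `0 ≤ t`
  with `q^{n-1} t < 1`, `∑_m #(Δ_m K/K) t^m < ∞` (the inverse is a product of geometric series
  with ratios `q^i t < 1`; `summable_coeff_prod_mk_pow_mul_pow`, Cauchy products of non-negative
  series). This sharpens the crude bound `#(Δ_m K/K) ≤ #(K t_1 K/K)^m` of
  `TamagawaHeckeSeries.ncard_cosets_glIntDet_le` (radius `(q-1)/(q^n-1)`) to the true radius, which
  is what the Hecke bound `|a| ≤ q^{(n-1)/2}` on Satake parameters of unitary representations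
  requires (`SatakeParameterHeckeBound`, the consumer).

## References

* G. Shimura, *Introduction to the arithmetic theory of automorphic functions*, Publ. Math. Soc.
  Japan 11 (1971), §3.2, Thm. 3.21, Lemmas 3.22–3.23 [ShimuraIATAF1971].
* T. Tamagawa, *On the ζ-functions of a division algebra*, Ann. of Math. 77 (1963), 387–405
  (the rationality theorem and the lattice count for general `n`).
-/

noncomputable section

open Module Submodule Finset

namespace Literature.NumberTheory.Automorphic

/-! ### The `q`-binomial theorem through subspace counts -/

section QBinomial

open Literature.LinearAlgebra.Subspace

variable {k W : Type*} [Field k] [Finite k] [AddCommGroup W] [Module k W] [FiniteDimensional k W]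

/-- **The `q`-binomial theorem through subspace counts.** Over a finite field `k` with
`q = Nat.card k` elements, for a subspace `C` of a finite-dimensional space `W` and any element
`x` of a commutative ring,
`∑_{j=0}^{dim W} (-1)^j q^{j(j-1)/2} #{Y : C ≤ Y ≤ W, codim Y = j} x^j = ∏_{i=0}^{codim C - 1} (1 - q^i x)`.
Since `#{Y ⊇ C : codim Y = j}` is the Gaussian binomial `[m choose j]_q`, `m = codim C`, this is
Gauss's `∑_j (-1)^j q^{j(j-1)/2} [m choose j]_q x^j = ∏_{i<m} (1 - q^i x)`; at `x = 1` it is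
Shimura's Lemma 3.23 (`sum_neg_one_pow_mul_pow_choose_mul_card_ge_codim`). Proof by induction on
the codimension through the recursion `card_ge_codim_eq_add`
(`A(C, j+1) = A(C + ke, j+1) + q^{dim W - dim C - (j+1)} A(C + ke, j)` for `e ∉ C`), which gives
`S_C(x) = (1 - q^{codim C - 1} x) S_{C + ke}(x)`. [folklore] -/
theorem sum_card_ge_codim_mul_pow_eq_prod {R : Type*} [CommRing R] (C : Submodule k W) (x : R) :
    ∑ j ∈ Finset.range (finrank k W + 1), (-1 : R) ^ j * (Nat.card k : R) ^ (j.choose 2) *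
        (Nat.card {Y : Submodule k W // C ≤ Y ∧ finrank k Y + j = finrank k W} : R) * x ^ j =
      ∏ i ∈ Finset.range (finrank k W - finrank k C), (1 - (Nat.card k : R) ^ i * x) := by
  suffices h : ∀ (d : ℕ) (C : Submodule k W), finrank k W - finrank k C = d →
      ∑ j ∈ Finset.range (finrank k W + 1), (-1 : R) ^ j * (Nat.card k : R) ^ (j.choose 2) *
        (Nat.card {Y : Submodule k W // C ≤ Y ∧ finrank k Y + j = finrank k W} : R) * x ^ j =
      ∏ i ∈ Finset.range d, (1 - (Nat.card k : R) ^ i * x) from h _ C rfl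
  intro d
  induction d using Nat.strong_induction_on with
  | _ d ih =>
  intro C hd
  set n := finrank k W with hn
  set q : R := (Nat.card k : R) with hq
  by_cases hC : C = ⊤
  · -- only `j = 0` contributes, and the product is empty
    subst hC
    have hd0 : d = 0 := by rw [← hd, finrank_top]; omega
    rw [hd0, Finset.prod_range_zero, Finset.sum_range_succ', card_ge_codim_zero]
    rw [Finset.sum_eq_zero fun j _ => ?_]
    · simp
    · rw [card_ge_codim_eq_zero ⊤ (by rw [finrank_top]; omega)]
      simp
  -- a vector outside `C`
  obtain ⟨e, he⟩ : ∃ e : W, e ∉ C := by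
    by_contra! h
    exact hC (eq_top_iff.mpr fun x _ => h x)
  set C' := C ⊔ (k ∙ e) with hC'
  have hdimC' : finrank k C' = finrank k C + 1 := Submodule.finrank_sup_span_singleton he
  have hCn : finrank k C + 1 ≤ n := by
    rw [← hdimC', hn, ← finrank_top (R := k) (M := W)]
    exact Submodule.finrank_mono le_top
  -- the induction hypothesis for `C'`
  have ih' := ih (n - finrank k C') (by omega) C' rfl
  -- abbreviations for the graded counts
  set A : ℕ → R := fun j =>
    (Nat.card {Y : Submodule k W // C ≤ Y ∧ finrank k Y + j = n} : R) with hA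
  set A' : ℕ → R := fun j =>
    (Nat.card {Y : Submodule k W // C' ≤ Y ∧ finrank k Y + j = n} : R) with hA'
  -- the recursion, termwise, for `j + 1`
  have hrec : ∀ j, A (j + 1) = A' (j + 1) + q ^ (n - finrank k C - (j + 1)) * A' j := by
    intro j
    simp only [hA, hA', hq]
    rw [card_ge_codim_eq_add C he (Nat.le_add_left 1 j), Nat.add_sub_cancel]
    push_cast
    ring
  -- vanishing of `A' j` beyond the maximal codimension `n - dim C - 1`
  have hA'0 : ∀ j, n - finrank k C - 1 < j → A' j = 0 := by
    intro j hj
    simp only [hA']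
    rw [card_ge_codim_eq_zero C' (by omega), Nat.cast_zero]
  have hA'n : A' n = 0 := hA'0 n (by omega)
  have hS' : ∑ j ∈ Finset.range (n + 1), (-1 : R) ^ j * q ^ (j.choose 2) * A' j * x ^ j =
      ∑ j ∈ Finset.range n, (-1 : R) ^ j * q ^ (j.choose 2) * A' j * x ^ j := by
    rw [Finset.sum_range_succ, hA'n, mul_zero, zero_mul, add_zero]
  have key : ∑ j ∈ Finset.range (n + 1), (-1 : R) ^ j * q ^ (j.choose 2) * A j * x ^ j =
      (1 - q ^ (n - finrank k C - 1) * x) *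
        ∑ j ∈ Finset.range (n + 1), (-1 : R) ^ j * q ^ (j.choose 2) * A' j * x ^ j := by
    rw [Finset.sum_range_succ' _ n,
      Finset.sum_range_succ' (fun j => (-1 : R) ^ j * _ * A' j * x ^ j) n]
    have h0 : A 0 = 1 := by simp only [hA]; rw [card_ge_codim_zero]; simp
    have h0' : A' 0 = 1 := by simp only [hA']; rw [card_ge_codim_zero]; simp
    simp only [h0, h0', pow_zero, Nat.choose_zero_succ, mul_one]
    have hterm : ∀ j ∈ Finset.range n,
        (-1 : R) ^ (j + 1) * q ^ ((j + 1).choose 2) * A (j + 1) * x ^ (j + 1) =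
        (-1 : R) ^ (j + 1) * q ^ ((j + 1).choose 2) * A' (j + 1) * x ^ (j + 1) -
          q ^ (n - finrank k C - 1) * x * ((-1 : R) ^ j * q ^ (j.choose 2) * A' j * x ^ j) := by
      intro j _
      rw [hrec j]
      by_cases hj : j ≤ n - finrank k C - 1
      · have e1 : (j + 1).choose 2 = j.choose 2 + j := by
          rw [Nat.choose_succ_left _ _ (by norm_num : 0 < 2), Nat.choose_one_right]; ring
        have hpow : q ^ ((j + 1).choose 2) * q ^ (n - finrank k C - (j + 1)) =
            q ^ (n - finrank k C - 1) * q ^ (j.choose 2) := by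
          rw [e1, ← pow_add, ← pow_add]
          congr 1
          omega
        calc (-1 : R) ^ (j + 1) * q ^ ((j + 1).choose 2) *
              (A' (j + 1) + q ^ (n - finrank k C - (j + 1)) * A' j) * x ^ (j + 1)
            = (-1 : R) ^ (j + 1) * q ^ ((j + 1).choose 2) * A' (j + 1) * x ^ (j + 1) +
                (-1 : R) ^ (j + 1) * (q ^ ((j + 1).choose 2) * q ^ (n - finrank k C - (j + 1))) *
                  A' j * x ^ (j + 1) := by ring
          _ = (-1 : R) ^ (j + 1) * q ^ ((j + 1).choose 2) * A' (j + 1) * x ^ (j + 1) +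
                (-1 : R) ^ (j + 1) * (q ^ (n - finrank k C - 1) * q ^ (j.choose 2)) *
                  A' j * x ^ (j + 1) := by rw [hpow]
          _ = _ := by ring
      · rw [hA'0 j (by omega)]
        ring
    rw [Finset.sum_congr rfl hterm, Finset.sum_sub_distrib, ← Finset.mul_sum, ← hS',
      Finset.sum_range_succ' (fun j => (-1 : R) ^ j * _ * A' j * x ^ j) n]
    simp only [h0', pow_zero, Nat.choose_zero_succ, mul_one]
    ring
  change ∑ j ∈ Finset.range (n + 1), (-1 : R) ^ j * q ^ (j.choose 2) * A j * x ^ j = _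
  rw [key, ih']
  have hd' : d = (n - finrank k C') + 1 := by omega
  have hexp : n - finrank k C - 1 = n - finrank k C' := by omega
  rw [hd', Finset.prod_range_succ, hexp, mul_comm]

end QBinomial

/-! ### The left cosets of `K t_i K` and of `Δ_m`, counted -/

section CosetCount

open MulAction ValuativeRel Literature.NumberTheory.Automorphic.Echelon
  Literature.LinearAlgebra.Matrix.Echelon

variable {F : Type*} [Field F] [ValuativeRel F] {n : ℕ} {ϖ : F}

omit [ValuativeRel F] in
/-- `t_i = diag(ϖ 1_i, 1_{n-i}) = ϖ^{ε}` with `ε = 𝟙_{j < i}`. [folklore] -/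
theorem heckeDiag_eq_piPowGL (hϖ : ϖ ≠ 0) (i : ℕ) :
    heckeDiag n (Units.mk0 ϖ hϖ) i = piPowGL hϖ (fun j => if (j : ℕ) < i then 1 else 0) := by
  refine Units.ext ?_
  rw [coe_heckeDiag, coe_piPowGL, piPow]
  congr 1
  ext j
  split_ifs <;> simp

omit [ValuativeRel F] in
/-- The scalar matrix `ϖ^c · 1 = ϖ^{(c, …, c)}` is central in `GL_n(F)`. [folklore] -/
theorem mul_piPowGL_const (hϖ : ϖ ≠ 0) (c : ℕ) (g : GL (Fin n) F) :
    g * piPowGL hϖ (fun _ => c) = piPowGL hϖ (fun _ => c) * g := by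
  refine Units.ext ?_
  rw [Units.val_mul, Units.val_mul, coe_piPowGL, piPow, ← Matrix.smul_one_eq_diagonal,
    Matrix.mul_smul, Matrix.smul_mul, Matrix.mul_one, Matrix.one_mul]

/-- For `α ∈ K t_i K / K` (`i ≤ n`) the matrix `α.out⁻¹ (ϖ · 1)` is integral: `α.out = κ t_i h` with
`κ, h ∈ K`, and `t_i⁻¹ (ϖ · 1) = diag(1_i, ϖ 1_{n-i})`. [folklore] -/
theorem isIntegralMatrix_out_inv_mul_piPowGL_one (hϖ : IsUniformizingElement ϖ) {i : ℕ}
    {α : GL (Fin n) F ⧸ glInt n F}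
    (hα : α ∈ orbit (glInt n F)
      ((heckeDiag n (Units.mk0 ϖ hϖ.ne_zero) i : GL (Fin n) F) : GL (Fin n) F ⧸ glInt n F)) :
    IsIntegralMatrix (((α.out)⁻¹ * piPowGL hϖ.ne_zero (fun _ : Fin n => 1) : GL (Fin n) F) :
      Matrix (Fin n) (Fin n) F) := by
  obtain ⟨κ, rfl⟩ := (mem_orbit_mk_iff (glInt n F)).1 hα
  obtain ⟨h, hh⟩ := QuotientGroup.mk_out_eq_mul (glInt n F)
    ((κ : GL (Fin n) F) * heckeDiag n (Units.mk0 ϖ hϖ.ne_zero) i)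
  rw [hh]
  set t : GL (Fin n) F := heckeDiag n (Units.mk0 ϖ hϖ.ne_zero) i with ht
  set w : GL (Fin n) F := piPowGL hϖ.ne_zero (fun _ : Fin n => 1) with hw
  set d : GL (Fin n) F := piPowGL hϖ.ne_zero (fun j => if (j : ℕ) < i then 0 else 1) with hd
  have htd : t * d = w := by
    refine Units.ext ?_
    rw [ht, heckeDiag_eq_piPowGL, hd, hw, Units.val_mul, coe_piPowGL, coe_piPowGL, coe_piPowGL,
      piPow, piPow, piPow, Matrix.diagonal_mul_diagonal]
    congr 1
    ext j
    rw [← pow_add]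
    congr 1
    split_ifs <;> simp
  have he : ((κ : GL (Fin n) F) * t * (h : GL (Fin n) F))⁻¹ * w =
      (h : GL (Fin n) F)⁻¹ * d * (κ : GL (Fin n) F)⁻¹ := by
    have hc := mul_piPowGL_const hϖ.ne_zero 1 ((κ : GL (Fin n) F))⁻¹
    rw [← hw] at hc
    calc ((κ : GL (Fin n) F) * t * (h : GL (Fin n) F))⁻¹ * w
        = (h : GL (Fin n) F)⁻¹ * t⁻¹ * ((κ : GL (Fin n) F)⁻¹ * w) := by group
      _ = (h : GL (Fin n) F)⁻¹ * t⁻¹ * (w * (κ : GL (Fin n) F)⁻¹) := by rw [hc]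
      _ = (h : GL (Fin n) F)⁻¹ * (t⁻¹ * (t * d)) * (κ : GL (Fin n) F)⁻¹ := by rw [htd]; group
      _ = (h : GL (Fin n) F)⁻¹ * d * (κ : GL (Fin n) F)⁻¹ := by rw [inv_mul_cancel_left]
  rw [he, Units.val_mul, Units.val_mul]
  refine ((isIntegralMatrix_of_mem_glInt ((glInt n F).inv_mem h.2)).mul ?_).mul
    (isIntegralMatrix_of_mem_glInt ((glInt n F).inv_mem κ.2))
  rw [hd, coe_piPowGL]
  exact isIntegralMatrix_piPow hϖ.mem _

/-- **The degree of `T_i`: `#(K t_i K / K)` is the number of subspaces of `𝓀ⁿ` of codimension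
`i`** (`i ≤ n`; the lattices `L'` with `ϖ 𝒪ⁿ ⊆ L' ⊆ 𝒪ⁿ`, `𝒪ⁿ/L' ≅ 𝓀^i`; Shimura (1971), §3.2,
proof of Lemma 3.22). From `ncard_orbit_heckeDiag_isIntegralMatrix` with `w = ϖ · 1`, for which
the integrality condition is automatic and the residue column space is `0`. [folklore] -/
theorem ncard_orbit_heckeDiag_eq_card_submodule [Finite 𝓀[F]] (hϖ : IsUniformizingElement ϖ)
    {i : ℕ} (hi : i ≤ n) :
    (orbit (glInt n F) ((heckeDiag n (Units.mk0 ϖ hϖ.ne_zero) i : GL (Fin n) F) :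
        GL (Fin n) F ⧸ glInt n F)).ncard =
      Nat.card {Y : Submodule 𝓀[F] (Fin n → 𝓀[F]) // ⊥ ≤ Y ∧
        Module.finrank 𝓀[F] Y + i = Module.finrank 𝓀[F] (Fin n → 𝓀[F])} := by
  classical
  set w₀ : Matrix (Fin n) (Fin n) 𝒪[F] := Matrix.diagonal fun _ => (⟨ϖ, hϖ.mem⟩ : 𝒪[F]) with hw₀
  have hw : ((piPowGL hϖ.ne_zero (fun _ : Fin n => 1) : GL (Fin n) F) : Matrix (Fin n) (Fin n) F) =
      w₀.map (𝒪[F]).subtype := by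
    rw [coe_piPowGL, piPow, hw₀, Matrix.diagonal_map (Subring.subtype 𝒪[F]).map_zero]
    congr 1
    ext j
    simp
  have h := ncard_orbit_heckeDiag_isIntegralMatrix hϖ hi w₀ hw
  have hall : {α ∈ orbit (glInt n F) ((heckeDiag n (Units.mk0 ϖ hϖ.ne_zero) i : GL (Fin n) F) :
      GL (Fin n) F ⧸ glInt n F) | IsIntegralMatrix (((α.out)⁻¹ *
        piPowGL hϖ.ne_zero (fun _ : Fin n => 1) : GL (Fin n) F) : Matrix (Fin n) (Fin n) F)} =
      orbit (glInt n F) ((heckeDiag n (Units.mk0 ϖ hϖ.ne_zero) i : GL (Fin n) F) :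
        GL (Fin n) F ⧸ glInt n F) := by
    ext α
    simp only [Set.mem_setOf_eq, and_iff_left_iff_imp]
    exact isIntegralMatrix_out_inv_mul_piPowGL_one hϖ
  have hspan : Submodule.span 𝓀[F] (Set.range fun j => fun i =>
      IsLocalRing.residue 𝒪[F] (w₀ i j)) = ⊥ := by
    rw [Submodule.span_eq_bot]
    rintro _ ⟨j, rfl⟩
    ext i'
    simp only [hw₀, Matrix.diagonal_apply, Pi.zero_apply]
    split_ifs
    · exact residue_eq_zero_of_valuation_lt_one hϖ.valuation_lt_one
    · exact map_zero _
  rw [hall] at h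
  rw [h, card_submodule_finrank_eq_sub _ hi, hspan]

/-- **The Hecke polynomial of the trivial representation is `∏_{i<n} (1 - q^i X)`** (the
`q`-binomial theorem through subspace counts): in any commutative ring,
`∑_{i ≤ n} (-1)^i q^{i(i-1)/2} #(K t_i K/K) x^i = ∏_{i<n} (1 - q^i x)`
(`ncard_orbit_heckeDiag_eq_card_submodule` and `sum_card_ge_codim_mul_pow_eq_prod` for `C = 0`).
[folklore] -/
theorem sum_ncard_orbit_heckeDiag_mul_pow_eq_prod [Finite 𝓀[F]] (hϖ : IsUniformizingElement ϖ)
    {R : Type*} [CommRing R] (x : R) :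
    ∑ i ∈ Finset.range (n + 1), (-1 : R) ^ i * (Nat.card 𝓀[F] : R) ^ (i.choose 2) *
        ((orbit (glInt n F) ((heckeDiag n (Units.mk0 ϖ hϖ.ne_zero) i : GL (Fin n) F) :
          GL (Fin n) F ⧸ glInt n F)).ncard : R) * x ^ i =
      ∏ i ∈ Finset.range n, (1 - (Nat.card 𝓀[F] : R) ^ i * x) := by
  haveI : Fintype 𝓀[F] := Fintype.ofFinite _
  have h := sum_card_ge_codim_mul_pow_eq_prod (k := 𝓀[F]) (W := Fin n → 𝓀[F])
    (⊥ : Submodule 𝓀[F] (Fin n → 𝓀[F])) x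
  rw [finrank_bot, Nat.sub_zero, Module.finrank_fin_fun] at h
  rw [← h]
  refine Finset.sum_congr rfl fun i hi => ?_
  rw [Finset.mem_range, Nat.lt_succ_iff] at hi
  rw [ncard_orbit_heckeDiag_eq_card_submodule hϖ hi, Module.finrank_fin_fun]

/-- **Tamagawa's identity for the trivial representation: the generating function of the
numbers `#(Δ_m K / K)` of left cosets of integral matrices of determinant valuation `m`.**
`(∑_m #(Δ_m K/K) X^m) · ∏_{i<n} (1 - q^i X) = 1` in `ℝ⟦X⟧`, i.e.
`∑_m #(Δ_m K/K) X^m = ∏_{i=0}^{n-1} (1 - q^i X)⁻¹` (the classical count of the sublattices of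
`𝒪ⁿ` of index `q^m` by Hermite normal forms; here: Shimura (1971), Thm. 3.21 applied to the
trivial one-dimensional representation, on which `[K g K]` acts by the degree `#(K g K/K)`, and
the `q`-binomial theorem `sum_ncard_orbit_heckeDiag_mul_pow_eq_prod`).
[cite: ShimuraIATAF1971, Theorem 3.21] -/
theorem mk_ncard_cosets_glIntDet_mul_prod_eq_one [Finite 𝓀[F]] (hϖ : IsUniformizingElement ϖ) :
    PowerSeries.mk (fun m => ({γ : GL (Fin n) F ⧸ glInt n F | γ.out ∈ glIntDet n ϖ m}.ncard : ℝ)) *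
      ∏ i ∈ Finset.range n, (1 - PowerSeries.C ((Nat.card 𝓀[F] : ℝ) ^ i) * PowerSeries.X) = 1 := by
  classical
  -- the trivial representation of `GL_n(F)` on `ℝ`, and its fixed vector `1`
  set ρ : Representation ℝ (GL (Fin n) F) ℝ := 1 with hρ
  have hρg : ∀ (g : GL (Fin n) F) (v : ℝ), ρ g v = v := fun g v => by simp [hρ]
  have hv : (1 : ℝ) ∈ ρ.fixedPoints (glInt n F) :=
    (ρ.mem_fixedPoints (glInt n F) 1).2 fun g _ => hρg g 1
  -- `[K t_i K]` acts by the degree, `T(ϖ^m)` by `#(Δ_m K/K)`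
  have hτ : ∀ i ≤ n, heckeOperator ρ (glInt n F) (heckeDiag n (Units.mk0 ϖ hϖ.ne_zero) i) 1 =
      ((orbit (glInt n F) ((heckeDiag n (Units.mk0 ϖ hϖ.ne_zero) i : GL (Fin n) F) :
        GL (Fin n) F ⧸ glInt n F)).ncard : ℝ) • (1 : ℝ) := by
    intro i hi
    rw [heckeOperator_apply_eq_sum_out ρ (glInt n F) _ (finite_orbit_heckeDiag hϖ hi) hv]
    simp only [hρg, Finset.sum_const, nsmul_eq_mul, mul_one, smul_eq_mul]
    rw [Set.ncard_eq_toFinset_card _ (finite_orbit_heckeDiag hϖ hi)]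
  have hr : ∀ m, heckeDetOperator ρ ϖ m 1 =
      (({γ : GL (Fin n) F ⧸ glInt n F | γ.out ∈ glIntDet n ϖ m}.ncard : ℝ)) • (1 : ℝ) := by
    intro m
    rw [heckeDetOperator_apply_eq_sum ρ m (finite_cosets_glIntDet hϖ m)]
    simp only [hρg, Finset.sum_const, nsmul_eq_mul, mul_one, smul_eq_mul]
    rw [Set.ncard_eq_toFinset_card _ (finite_cosets_glIntDet hϖ m)]
  have h := mk_heckeDetEigenvalue_mul_heckePolynomial_eq_one ρ hϖ hv one_ne_zero hτ hr
  -- the Hecke polynomial of the trivial representation, coerced to `ℝ⟦X⟧`, is `∏ (1 - q^i X)`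
  have hpoly : ((∑ i ∈ Finset.range (n + 1), Polynomial.C ((-1 : ℝ) ^ i *
      (Nat.card 𝓀[F] : ℝ) ^ i.choose 2 * ((orbit (glInt n F)
        ((heckeDiag n (Units.mk0 ϖ hϖ.ne_zero) i : GL (Fin n) F) : GL (Fin n) F ⧸ glInt n F)).ncard : ℝ)) *
          Polynomial.X ^ i : Polynomial ℝ) : PowerSeries ℝ) =
      ∏ i ∈ Finset.range n, (1 - PowerSeries.C ((Nat.card 𝓀[F] : ℝ) ^ i) * PowerSeries.X) := by
    rw [Finset.prod_congr rfl fun i _ => by rw [map_pow, map_natCast],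
      ← sum_ncard_orbit_heckeDiag_mul_pow_eq_prod hϖ (PowerSeries.X : PowerSeries ℝ)]
    have hms := map_sum (Polynomial.coeToPowerSeries.ringHom : Polynomial ℝ →+* PowerSeries ℝ)
      (fun i => Polynomial.C ((-1 : ℝ) ^ i * (Nat.card 𝓀[F] : ℝ) ^ i.choose 2 * ((orbit (glInt n F)
        ((heckeDiag n (Units.mk0 ϖ hϖ.ne_zero) i : GL (Fin n) F) : GL (Fin n) F ⧸ glInt n F)).ncard : ℝ)) *
          Polynomial.X ^ i) (Finset.range (n + 1))
    simp only [Polynomial.coeToPowerSeries.ringHom_apply] at hms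
    rw [hms]
    refine Finset.sum_congr rfl fun i _ => ?_
    rw [Polynomial.coe_mul, Polynomial.coe_pow, Polynomial.coe_C, Polynomial.coe_X, map_mul, map_mul,
      map_pow, map_pow, map_neg, map_one, map_natCast, map_natCast]
  rwa [hpoly] at h

/-! ### Convergence of the coset-counting series `∑_m #(Δ_m K/K) t^m` for `t q^{n-1} < 1` -/

/-- `(∑_m a^m X^m)(1 - a X) = 1` in `R⟦X⟧`. [folklore] -/
theorem mk_pow_mul_one_sub_eq_one {R : Type*} [CommRing R] (a : R) :
    PowerSeries.mk (fun m => a ^ m) * (1 - PowerSeries.C a * PowerSeries.X) = 1 := by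
  have h := congrArg (PowerSeries.rescale a) (PowerSeries.mk_one_mul_one_sub_eq_one R)
  rw [map_mul, map_sub, map_one, PowerSeries.rescale_X, PowerSeries.rescale_mk] at h
  simpa using h

/-- `(∏_{i<N} ∑_m c_i^m X^m) · ∏_{i<N} (1 - c_i X) = 1`. [folklore] -/
theorem prod_mk_pow_mul_prod_one_sub_eq_one {R : Type*} [CommRing R] (c : ℕ → R) (N : ℕ) :
    (∏ i ∈ Finset.range N, PowerSeries.mk fun m => c i ^ m) *
      ∏ i ∈ Finset.range N, (1 - PowerSeries.C (c i) * PowerSeries.X) = 1 := by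
  rw [← Finset.prod_mul_distrib]
  exact Finset.prod_eq_one fun i _ => mk_pow_mul_one_sub_eq_one (c i)

/-- The coefficients of `∏_{i<N} ∑_m c_i^m X^m` are non-negative for `c_i ≥ 0`. [folklore] -/
theorem coeff_prod_mk_pow_nonneg {c : ℕ → ℝ} (hc : ∀ i, 0 ≤ c i) (N m : ℕ) :
    0 ≤ PowerSeries.coeff m (∏ i ∈ Finset.range N, PowerSeries.mk fun m => c i ^ m) := by
  induction N generalizing m with
  | zero =>
    rw [Finset.prod_range_zero, PowerSeries.coeff_one]
    split_ifs <;> norm_num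
  | succ N ih =>
    rw [Finset.prod_range_succ, PowerSeries.coeff_mul]
    exact Finset.sum_nonneg fun p _ => mul_nonneg (ih p.1) (by
      rw [PowerSeries.coeff_mk]; exact pow_nonneg (hc N) _)

/-- **Summability of the weighted coefficients of a product of geometric series**: for `c_i ≥ 0`,
`t ≥ 0` with `c_i t < 1` (`i < N`), `∑_m coeff_m(∏_{i<N} ∑_k c_i^k X^k) t^m < ∞` (induction on
`N`; the step is the Cauchy product of two convergent series of non-negative terms). [folklore] -/
theorem summable_coeff_prod_mk_pow_mul_pow {c : ℕ → ℝ} (hc : ∀ i, 0 ≤ c i) {t : ℝ} (ht : 0 ≤ t)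
    {N : ℕ} (htc : ∀ i < N, c i * t < 1) :
    Summable fun m =>
      PowerSeries.coeff m (∏ i ∈ Finset.range N, PowerSeries.mk fun m => c i ^ m) * t ^ m := by
  induction N with
  | zero =>
    refine summable_of_ne_finset_zero (s := {0}) fun m hm => ?_
    rw [Finset.mem_singleton] at hm
    rw [Finset.prod_range_zero, PowerSeries.coeff_one, if_neg hm, zero_mul]
  | succ N ih =>
    have ih' := ih fun i hi => htc i (Nat.lt_succ_of_lt hi)
    set P : PowerSeries ℝ := ∏ i ∈ Finset.range N, PowerSeries.mk fun m => c i ^ m with hP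
    have hgeom : Summable fun m : ℕ => c N ^ m * t ^ m := by
      simp_rw [← mul_pow]
      exact summable_geometric_of_lt_one (mul_nonneg (hc N) ht) (htc N (Nat.lt_succ_self N))
    have hf0 : ∀ m, 0 ≤ PowerSeries.coeff m P * t ^ m := fun m =>
      mul_nonneg (coeff_prod_mk_pow_nonneg hc N m) (pow_nonneg ht m)
    have hg0 : ∀ m, 0 ≤ c N ^ m * t ^ m := fun m => mul_nonneg (pow_nonneg (hc N) m) (pow_nonneg ht m)
    have hprod : Summable fun x : ℕ × ℕ =>
        (PowerSeries.coeff x.1 P * t ^ x.1) * (c N ^ x.2 * t ^ x.2) :=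
      ih'.mul_of_nonneg hgeom hf0 hg0
    have hanti : Summable fun m => ∑ kl ∈ Finset.HasAntidiagonal.antidiagonal m,
        (PowerSeries.coeff kl.1 P * t ^ kl.1) * (c N ^ kl.2 * t ^ kl.2) :=
      summable_sum_mul_antidiagonal_of_summable_mul (f := fun a => PowerSeries.coeff a P * t ^ a)
        (g := fun b => c N ^ b * t ^ b) hprod
    refine hanti.congr fun m => ?_
    rw [Finset.prod_range_succ, PowerSeries.coeff_mul, Finset.sum_mul]
    refine Finset.sum_congr rfl fun p hp => ?_
    rw [Finset.HasAntidiagonal.mem_antidiagonal] at hp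
    rw [PowerSeries.coeff_mk, ← hp, pow_add]
    ring

/-- **The coset-counting series converges for `t q^{n-1} < 1`:** `∑_m #(Δ_m K/K) t^m < ∞` for
`0 ≤ t` with `q^{n-1} t < 1` — the radius of convergence of `∏_{i<n} (1 - q^i X)⁻¹` is
`q^{-(n-1)}` (`mk_ncard_cosets_glIntDet_mul_prod_eq_one`, `summable_coeff_prod_mk_pow_mul_pow`);
equivalently `#(Δ_m K/K) = h_m(1, q, …, q^{n-1})` grows like `q^{(n-1)m}` up to a polynomial
factor. [folklore] -/
theorem summable_ncard_cosets_glIntDet_mul_pow [Finite 𝓀[F]] (hϖ : IsUniformizingElement ϖ)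
    {t : ℝ} (ht : 0 ≤ t) (htq : (Nat.card 𝓀[F] : ℝ) ^ (n - 1) * t < 1) :
    Summable fun m => ({γ : GL (Fin n) F ⧸ glInt n F | γ.out ∈ glIntDet n ϖ m}.ncard : ℝ) * t ^ m := by
  set c : ℕ → ℝ := fun i => (Nat.card 𝓀[F] : ℝ) ^ i with hc_def
  have hc : ∀ i, 0 ≤ c i := fun i => pow_nonneg (Nat.cast_nonneg _) i
  have hq1 : (1 : ℝ) ≤ Nat.card 𝓀[F] := by
    haveI : Fintype 𝓀[F] := Fintype.ofFinite _
    exact_mod_cast Nat.one_le_iff_ne_zero.mpr (Nat.card_pos (α := 𝓀[F])).ne'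
  have htc : ∀ i < n, c i * t < 1 := fun i hi =>
    lt_of_le_of_lt (mul_le_mul_of_nonneg_right (pow_le_pow_right₀ hq1 (by omega)) ht) htq
  -- the two inverses of `∏ (1 - q^i X)` agree
  set Q : PowerSeries ℝ := ∏ i ∈ Finset.range n, (1 - PowerSeries.C (c i) * PowerSeries.X) with hQ
  have h1 := mk_ncard_cosets_glIntDet_mul_prod_eq_one (n := n) hϖ
  have h2 := prod_mk_pow_mul_prod_one_sub_eq_one c n
  have heq : PowerSeries.mk (fun m => ({γ : GL (Fin n) F ⧸ glInt n F | γ.out ∈ glIntDet n ϖ m}.ncard : ℝ)) =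
      ∏ i ∈ Finset.range n, PowerSeries.mk fun m => c i ^ m := by
    have hQ1 : Q * ∏ i ∈ Finset.range n, PowerSeries.mk (fun m => c i ^ m) = 1 := by
      rw [mul_comm]; exact h2
    calc PowerSeries.mk (fun m => ({γ : GL (Fin n) F ⧸ glInt n F | γ.out ∈ glIntDet n ϖ m}.ncard : ℝ))
        = PowerSeries.mk (fun m => ({γ : GL (Fin n) F ⧸ glInt n F | γ.out ∈ glIntDet n ϖ m}.ncard : ℝ)) *
            (Q * ∏ i ∈ Finset.range n, PowerSeries.mk (fun m => c i ^ m)) := by rw [hQ1, mul_one]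
      _ = ∏ i ∈ Finset.range n, PowerSeries.mk fun m => c i ^ m := by
            rw [← mul_assoc, hQ, h1, one_mul]
  refine (summable_coeff_prod_mk_pow_mul_pow hc ht htc).congr fun m => ?_
  rw [← heq, PowerSeries.coeff_mk]

end CosetCount

end Literature.NumberTheory.Automorphic
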